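import Summits.BirchSwinnertonDyer.BirchSwinnertonDyer.Theorems.ResidualThetaTransportAtTwoThetaTransportResidualCharpoly
import Summits.BirchSwinnertonDyer.BirchSwinnertonDyer.Theorems.ResidualThetaTransportAtTwoThetaTransportResidualNoLine
import Literature.NumberTheory.EllipticCurves.CyclotomicZpExtension
import HarnessLib

/-!
# The residual isomorphism `A_g[ϖ] ≅ W[2]^{⊕f}` of the θ-transport line, as Γ_ℚ-modules (carriers and assembly)
# — stub `stub_transport` (b) of line «bt26-lambda» on crux (R≥)ᵖ, KERNEL-CHECKED

Route `ResidualThetaTransportAtTwo` (RTT), crux (R≥)ᵖ `ResidualThetaCountLowerPureAtTwo`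
(stmt-BirchSwinnertonDyer-26074), line «bt26-lambda»; seat `prover-bsd-wall-rtt-p2` g12 (`--supports`, closes nothing).
HONEST FRAMING: THEOREMS ONLY (no definition, no named fact, no instance, no `sorry`); nothing about any Selmer group
is asserted; BSD is not proved by any of this.

WHAT. With `𝒪 = padicCoeffIntegers (range ι)`, `E = padicCoeffField (range ι)`, `k = 𝒪/ϖ`, `A_g = GreenbergSelmer.Cofree ρ E`:
* §1 `exists_conj_rhoMat_map_eq` — `ρ̄_{W,2} ⊗_f k` and `ρ mod ϖ` are CONJUGATE in `GL₂(k)` (companions: Chebotarev charpoly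
  congruence `charpoly_residual_eq_map_charpoly_rhoMat`, trace-one commutator, no stable line + Brauer–Nesbitt).
* §2 `exists_cofree_torsionCarrier` — the `g`-side carrier: an injective additive `jg : k² → A_g` onto `A_g[ϖ] = {a | ϖ•a = 0}` with
  `jg((ρ σ mod ϖ)·v) = σ • jg v` (`y ↦ (y/ϖ) mod 𝒪²`).
* §3 `exists_torsionPow_carrier` — the `W`-side carrier: for a ring map `f : 𝔽₂ → k` and `b : Fin d → k` with
  `c ↦ Σ f(c_j) b_j` bijective (an `𝔽₂`-basis of `k`), an additive bijection `jW : W[2]^d ≃ k²` with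
  `jW(σ • x) = (ρ̄_{W,2}(σ) ⊗ f)·jW x`.
* §4 `finite_residueField`, `exists_ringHom_basis` — `k` is a finite field of characteristic `2`: a ring map `f : 𝔽₂ → k` and
  an `𝔽₂`-basis of cardinality `d > 0` with `#k = 2^d`.
* §5 **`residualIso`** — the registered stub `stub_residualIso` of the reshaped skeleton VERBATIM: on the habitat (`GoodSS W 2`,
  `Δ_W < 0`), for the congruent newform datum `(g, ι)`, every framed `ρ : Γ_ℚ → GL₂(𝒪)` with the Frobenius polynomials
  `X² − ι(a_ℓ)X + ℓ` off `2M`, and every uniformiser `ϖ`: `∃ f > 0, #(𝒪/ϖ) = 2^f ∧ ∃ j : ((W[2^∞])[2])^f →+ A_g` injective,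
  `Γ_ℚ`-equivariant, with range `{a | ϖ • a = 0}`.

References: [DarmonDiamondTaylor1995] Prop. 2.6 (b); [DeligneSerreASENS1974] 6.7; [SerreInventiones1972] §5.3;
[EmertonPollackWeston2006] §3.1 (the cofree module `A_f`); [Greenberg1989] §1 p. 98.
-/

set_option autoImplicit false
-- the Theorems namespace of this sub repeats the summit name by design (D-0017 nested layout)
set_option linter.dupNamespace false

noncomputable section

open scoped MatrixGroups
open Matrix Polynomial WeierstrassCurve NumberField Field IsDedekindDomain
  Literature.NumberTheory.EllipticCurves Literature.NumberTheory.EllipticCurves.DokchitserDokchitser2012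
  Literature.NumberTheory.GaloisRepresentations Literature.NumberTheory.EllipticCurves.Rank1Residual
  Literature.NumberTheory.EllipticCurves.GreenbergSelmer Rat.HeightOneSpectrum

namespace Summit.BirchSwinnertonDyer.BirchSwinnertonDyer.Theorems.ThetaTransport

/-! ### §1. `ρ̄_{W,2} ⊗ k` and `ρ mod ϖ` are conjugate -/

section Conj

variable (W : WeierstrassCurve ℚ) [W.IsElliptic] [W.IsGloballyMinimal]

/-- **`ρ̄_{W,2} ⊗_f k = P · (ρ mod ϖ) · P⁻¹`** on the habitat, for the congruent datum of the θ-line: Chebotarev charpoly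
congruence (`charpoly_residual_eq_map_charpoly_rhoMat`) + trace-one commutator (`exists_trace_rhoMat_commutator_eq_one`)
+ no stable line and Brauer–Nesbitt (`exists_conj_map_eq_of_charpoly_eq_map`).
[cite: DarmonDiamondTaylor1995, Prop. 2.6 (b) (PDF p. 53)] [cite: DeligneSerreASENS1974, 6.7] -/
theorem exists_conj_rhoMat_map_eq (hss : GoodSS W 2) (hΔ : W.Δ < 0) {M : ℕ} [NeZero M]
    (g : CuspForm (CongruenceSubgroup.Gamma0 M) 2) (ι : ModularForms.coeffField g →+* PadicAlgCl 2)
    (hnew : ModularForms.IsNewform0 g)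
    (hcong : ∀ ℓ : ℕ, ℓ.Prime → ¬ ℓ ∣ 2 * M * W.conductorNorm ℤ →
      ‖embCoeff g ι ℓ - (W.frobeniusTrace ℓ : PadicAlgCl 2)‖ < 1)
    (ρ : FramedGaloisRep ℚ ↥(padicCoeffIntegers (Set.range ι)) 2)
    (hρ : ∀ v : HeightOneSpectrum (𝓞 ℚ), ¬ natGenerator v ∣ 2 * M →
      FramedGaloisRep.IsUnramifiedAt v ρ ∧ ∃ P : Polynomial ↥(padicCoeffIntegers (Set.range ι)),
        P.map (padicCoeffIntegers (Set.range ι)).subtype =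
          X ^ 2 - C (embCoeff g ι (natGenerator v)) * X + C ((natGenerator v : ℕ) : PadicAlgCl 2) ∧
        FramedGaloisRep.HasFrobCharpolyAt v P ρ)
    (ϖ : ↥(padicCoeffIntegers (Set.range ι))) (hϖ : Irreducible ϖ)
    (e : geomTorsion W 2 ≃+ (Fin 2 → ZMod 2))
    (f : ZMod 2 →+* (↥(padicCoeffIntegers (Set.range ι)) ⧸ Ideal.span {ϖ})) :
    ∃ P : GL (Fin 2) (↥(padicCoeffIntegers (Set.range ι)) ⧸ Ideal.span {ϖ}), ∀ σ : absoluteGaloisGroup ℚ,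
      (rhoMat W e σ).map f =
        (P : Matrix (Fin 2) (Fin 2) _) *
          ((ρ σ : GL (Fin 2) ↥(padicCoeffIntegers (Set.range ι))) :
            Matrix (Fin 2) (Fin 2) ↥(padicCoeffIntegers (Set.range ι))).map (Ideal.Quotient.mk (Ideal.span {ϖ})) *
          ((P⁻¹ : GL (Fin 2) _) : Matrix (Fin 2) (Fin 2) _) := by
  -- `k = 𝒪/ϖ` is a field
  haveI : FiniteDimensional ℚ (ModularForms.coeffField g) :=
    ModularForms.IsNewform0.finiteDimensional_coeffField_holds hnew
  haveI : FiniteDimensional ℚ_[2] ↥(padicCoeffField (Set.range ι)) :=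
    GreenbergSelmer.finiteDimensional_padicCoeffField ι
  haveI hdvr : IsDiscreteValuationRing ↥(padicCoeffIntegers (Set.range ι)) := by
    rw [padicCoeffIntegers_eq_unitBall]
    exact LambdaLowerBoundO.isDiscreteValuationRing_unitBall 2 _
  haveI hmax : (Ideal.span {ϖ} : Ideal ↥(padicCoeffIntegers (Set.range ι))).IsMaximal := by
    rw [← (IsDiscreteValuationRing.irreducible_iff_uniformizer ϖ).mp hϖ]
    exact IsLocalRing.maximalIdeal.isMaximal _
  letI : Field (↥(padicCoeffIntegers (Set.range ι)) ⧸ Ideal.span {ϖ}) := Ideal.Quotient.field _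
  let ψ : absoluteGaloisGroup ℚ →* GL (Fin 2) (↥(padicCoeffIntegers (Set.range ι)) ⧸ Ideal.span {ϖ}) :=
    (Matrix.GeneralLinearGroup.map (Ideal.Quotient.mk (Ideal.span {ϖ}))).comp ρ.toMonoidHom
  have hψ : ∀ σ, ((ψ σ : GL (Fin 2) _) : Matrix (Fin 2) (Fin 2) _) =
      ((ρ σ : GL (Fin 2) ↥(padicCoeffIntegers (Set.range ι))) :
        Matrix (Fin 2) (Fin 2) ↥(padicCoeffIntegers (Set.range ι))).map (Ideal.Quotient.mk (Ideal.span {ϖ})) :=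
    fun _ ↦ rfl
  have hchar : ∀ σ, ((ψ σ : GL (Fin 2) _) : Matrix (Fin 2) (Fin 2) _).charpoly = ((rhoMat W e σ).charpoly).map f :=
    fun σ ↦ by rw [hψ]; exact charpoly_residual_eq_map_charpoly_rhoMat W g ι hnew hcong ρ hρ ϖ hϖ e f σ
  obtain ⟨c, τ, hcτ⟩ := exists_trace_rhoMat_commutator_eq_one W hss hΔ (CyclotomicZp.zpExtension 2) e
  obtain ⟨P, hP⟩ := exists_conj_map_eq_of_charpoly_eq_map (rhoMat W e) f ψ hchar (det_rhoMat_eq_one W e)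
    ⟨c, τ, hcτ⟩
  exact ⟨P, fun σ ↦ by rw [hP σ, hψ]⟩

end Conj

/-! ### §2. The `g`-side carrier: `k² ≅ A_g[ϖ]`, equivariantly -/

section CofreeCarrier

variable {S : Set (PadicAlgCl 2)} {G : Type*} [Group G] [TopologicalSpace G]

/-- **The `ϖ`-torsion of the cofree module is `k²` with the reduced action.** For a framed `ρ : G → GL₂(𝒪)`
(`𝒪 = padicCoeffIntegers S`, `E = padicCoeffField S`, `A = Cofree ρ E = E²/𝒪²`) and `ϖ ∈ 𝒪`, `ϖ ≠ 0`, the map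
`y ↦ (y/ϖ) mod 𝒪²` induces an injective additive `jg : (𝒪/ϖ)² → A` with image `{a | ϖ • a = 0}` and
`jg ((ρ σ mod ϖ) · v) = σ • jg v`. [cite: EmertonPollackWeston2006, §3.1] [cite: Greenberg1989, §1 p. 98] -/
theorem exists_cofree_torsionCarrier (ρ : FramedRep G ↥(padicCoeffIntegers S) 2)
    (ϖ : ↥(padicCoeffIntegers S)) (hϖ0 : ϖ ≠ 0) :
    ∃ jg : (Fin 2 → ↥(padicCoeffIntegers S) ⧸ Ideal.span {ϖ}) →+ Cofree ρ ↥(padicCoeffField S),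
      Function.Injective jg ∧
      (∀ (σ : G) (v : Fin 2 → ↥(padicCoeffIntegers S) ⧸ Ideal.span {ϖ}),
        jg ((((ρ σ : GL (Fin 2) ↥(padicCoeffIntegers S)) : Matrix (Fin 2) (Fin 2) ↥(padicCoeffIntegers S)).map
          (Ideal.Quotient.mk (Ideal.span {ϖ}))) *ᵥ v) = σ • jg v) ∧
      Set.range jg = {a | ϖ • a = 0} := by
  classical
  -- `algebraMap 𝒪 E` is the inclusion; `ϖ ≠ 0` in `E`
  have halg : ∀ y : ↥(padicCoeffIntegers S), ((algebraMap ↥(padicCoeffIntegers S) ↥(padicCoeffField S) y : ↥(padicCoeffField S)) : PadicAlgCl 2) = (y : PadicAlgCl 2) := fun _ ↦ rfl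
  have halg_inj : Function.Injective (algebraMap ↥(padicCoeffIntegers S) ↥(padicCoeffField S)) := fun a b h ↦
    Subtype.ext (by rw [← halg, ← halg, h])
  have hϖE : (algebraMap ↥(padicCoeffIntegers S) ↥(padicCoeffField S) ϖ : ↥(padicCoeffField S)) ≠ 0 := fun h ↦ hϖ0 (halg_inj (by rw [h, map_zero]))
  -- `D y = y/ϖ` in `E²`, `𝒪`-linear, and `φ = (· mod 𝒪²) ∘ D`
  let D : (Fin 2 → ↥(padicCoeffIntegers S)) →ₗ[↥(padicCoeffIntegers S)] (Fin 2 → ↥(padicCoeffField S)) :=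
    { toFun := fun y i ↦ algebraMap ↥(padicCoeffIntegers S) ↥(padicCoeffField S) (y i) * (algebraMap ↥(padicCoeffIntegers S) ↥(padicCoeffField S) ϖ)⁻¹
      map_add' := fun y z ↦ by ext i; simp [add_mul]
      map_smul' := fun r y ↦ by ext i; simp [Algebra.smul_def, mul_assoc] }
  have hD : ∀ y i, D y i = algebraMap ↥(padicCoeffIntegers S) ↥(padicCoeffField S) (y i) * (algebraMap ↥(padicCoeffIntegers S) ↥(padicCoeffField S) ϖ)⁻¹ := fun _ _ ↦ rfl
  let φ : (Fin 2 → ↥(padicCoeffIntegers S)) →ₗ[↥(padicCoeffIntegers S)] Cofree ρ ↥(padicCoeffField S) := (cofreeMk ↥(padicCoeffField S) ρ).comp D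
  have hφ : ∀ y, φ y = cofreeMk ↥(padicCoeffField S) ρ (D y) := fun _ ↦ rfl
  -- `φ y = 0 ↔ ϖ ∣ y_i` for all `i`
  have hφ0 : ∀ y, φ y = 0 ↔ ∀ i, y i ∈ Ideal.span {ϖ} := by
    intro y
    rw [hφ, ← LinearMap.mem_ker, ker_cofreeMk, mem_lattice_iff]
    constructor
    · rintro ⟨z, hz⟩ i
      rw [Ideal.mem_span_singleton']
      refine ⟨z i, halg_inj ?_⟩
      have hi := congr_fun hz i
      rw [hD] at hi
      rw [map_mul, hi, inv_mul_cancel_right₀ hϖE]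
    · intro h
      choose z hz using fun i ↦ Ideal.mem_span_singleton'.mp (h i)
      refine ⟨z, funext fun i ↦ ?_⟩
      rw [hD, ← hz i, map_mul, mul_inv_cancel_right₀ hϖE]
  -- the coordinate maps through the quotient
  have hle : ∀ i : Fin 2, Ideal.span {ϖ} ≤ LinearMap.ker (φ.comp (LinearMap.single ↥(padicCoeffIntegers S) (fun _ : Fin 2 ↦ ↥(padicCoeffIntegers S)) i)) := by
    intro i x hx
    rw [LinearMap.mem_ker, LinearMap.comp_apply, hφ0]
    intro j
    by_cases hij : j = i
    · subst hij; simpa using hx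
    · simp [LinearMap.single_apply, hij]
  let jg : (Fin 2 → ↥(padicCoeffIntegers S) ⧸ Ideal.span {ϖ}) →ₗ[↥(padicCoeffIntegers S)] Cofree ρ ↥(padicCoeffField S) :=
    ∑ i : Fin 2, ((Ideal.span {ϖ}).liftQ _ (hle i)).comp (LinearMap.proj i)
  -- `jg (y mod ϖ) = φ y`
  have hjg : ∀ y : Fin 2 → ↥(padicCoeffIntegers S), jg (fun i ↦ Ideal.Quotient.mk (Ideal.span {ϖ}) (y i)) = φ y := by
    intro y
    simp only [jg, LinearMap.coe_sum, Finset.sum_apply, LinearMap.comp_apply, LinearMap.proj_apply]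
    have : ∀ i : Fin 2, (Ideal.span {ϖ}).liftQ _ (hle i) (Ideal.Quotient.mk (Ideal.span {ϖ}) (y i)) =
        φ (LinearMap.single ↥(padicCoeffIntegers S) (fun _ : Fin 2 ↦ ↥(padicCoeffIntegers S)) i (y i)) := fun i ↦ rfl
    simp only [this, ← map_sum]
    congr 1
    ext j
    simp [LinearMap.single_apply, Finset.sum_apply, Pi.single_apply]
  have hlift : ∀ v : Fin 2 → ↥(padicCoeffIntegers S) ⧸ Ideal.span {ϖ}, ∃ y : Fin 2 → ↥(padicCoeffIntegers S),
      (fun i ↦ Ideal.Quotient.mk (Ideal.span {ϖ}) (y i)) = v := fun v ↦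
    ⟨fun i ↦ (Ideal.Quotient.mk_surjective (v i)).choose,
      funext fun i ↦ (Ideal.Quotient.mk_surjective (v i)).choose_spec⟩
  refine ⟨jg.toAddMonoidHom, ?_, ?_, ?_⟩
  · -- injective
    intro v₁ v₂ h
    obtain ⟨y₁, rfl⟩ := hlift v₁
    obtain ⟨y₂, rfl⟩ := hlift v₂
    have h0 : φ (y₁ - y₂) = 0 := by
      rw [map_sub, ← hjg, ← hjg, sub_eq_zero]; exact h
    funext i
    rw [Ideal.Quotient.eq]
    simpa using (hφ0 _).mp h0 i
  · -- equivariance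
    intro σ v
    obtain ⟨y, rfl⟩ := hlift v
    have hmv : ((((ρ σ : GL (Fin 2) ↥(padicCoeffIntegers S)) : Matrix (Fin 2) (Fin 2) ↥(padicCoeffIntegers S)).map (Ideal.Quotient.mk (Ideal.span {ϖ}))) *ᵥ
        fun i ↦ Ideal.Quotient.mk (Ideal.span {ϖ}) (y i)) =
        fun i ↦ Ideal.Quotient.mk (Ideal.span {ϖ}) ((((ρ σ : GL (Fin 2) ↥(padicCoeffIntegers S)) : Matrix (Fin 2) (Fin 2) ↥(padicCoeffIntegers S)) *ᵥ y) i) := by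
      funext i; exact (RingHom.map_mulVec _ _ y i).symm
    change jg _ = σ • jg _
    rw [hmv, hjg, hjg, hφ, hφ, smul_cofreeMk]
    congr 1
    funext i
    rw [fracRepresentation_apply_apply, hD]
    simp only [Matrix.mulVec, dotProduct, Matrix.map_apply, hD, map_sum, map_mul, Finset.sum_mul]
    refine Finset.sum_congr rfl fun j _ ↦ ?_
    ring
  · -- range = `ϖ`-torsion
    ext a
    constructor
    · rintro ⟨v, rfl⟩
      obtain ⟨y, rfl⟩ := hlift v
      change ϖ • jg _ = 0
      rw [← map_smul, ← map_zero jg]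
      congr 1
      funext i
      rw [Pi.smul_apply, Pi.zero_apply, ← Ideal.Quotient.mk_eq_mk, ← Submodule.Quotient.mk_smul,
        Submodule.Quotient.mk_eq_zero, smul_eq_mul]
      exact Ideal.mul_mem_right _ _ (Ideal.mem_span_singleton_self ϖ)
    · intro ha
      obtain ⟨x, rfl⟩ := cofreeMk_surjective (F := ↥(padicCoeffField S)) ρ a
      have hx : ϖ • x ∈ lattice 2 ↥(padicCoeffIntegers S) ↥(padicCoeffField S) := by
        rw [← ker_cofreeMk (F := ↥(padicCoeffField S)) (ρ := ρ), LinearMap.mem_ker, map_smul]; exact ha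
      obtain ⟨y, hy⟩ := (mem_lattice_iff _).mp hx
      refine ⟨fun i ↦ Ideal.Quotient.mk (Ideal.span {ϖ}) (y i), ?_⟩
      change jg _ = _
      rw [hjg, hφ]
      congr 1
      funext i
      have hi := congr_fun hy i
      rw [Pi.smul_apply, Algebra.smul_def] at hi
      rw [hD, hi, mul_comm (algebraMap ↥(padicCoeffIntegers S) ↥(padicCoeffField S) ϖ) (x i),
        mul_inv_cancel_right₀ hϖE]

end CofreeCarrier

/-! ### §3. The `W`-side carrier: `W[2]^d ≅ k²` along an `𝔽₂`-basis of `k`, equivariantly -/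

section TorsionCarrier

variable (W : WeierstrassCurve ℚ)

/-- **`W[2]^{⊕d} ≅ W[2] ⊗ k = k²`**: for a frame `e : W[2] ≅ 𝔽₂²`, a ring map `f : 𝔽₂ → k` and a family `b : Fin d → k`
such that `c ↦ Σ_j f(c_j) b_j` is a bijection `𝔽₂^d ≅ k` (an `𝔽₂`-basis), the map `x ↦ (Σ_j f(e(x_j)_i) b_j)_i` is an
additive bijection `W[2]^d ≅ k²` intertwining the diagonal Galois action with `ρ̄_{W,2} ⊗_f k`.
[cite: SilvermanAEC2009, III.§7] -/
theorem exists_torsionPow_carrier (e : geomTorsion W 2 ≃+ (Fin 2 → ZMod 2)) {k : Type*} [CommRing k]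
    (f : ZMod 2 →+* k) {d : ℕ} (b : Fin d → k)
    (hb : Function.Bijective fun c : Fin d → ZMod 2 ↦ ∑ j, f (c j) * b j) :
    ∃ jW : (Fin d → geomTorsion W 2) ≃+ (Fin 2 → k),
      ∀ (σ : absoluteGaloisGroup ℚ) (x : Fin d → geomTorsion W 2),
        jW (fun j ↦ σ • x j) = ((rhoMat W e σ).map f) *ᵥ jW x := by
  classical
  set L : (Fin d → ZMod 2) → k := fun c ↦ ∑ j, f (c j) * b j with hLdef
  have hL : ∀ c, L c = ∑ j, f (c j) * b j := fun _ ↦ rfl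
  have hL_add : ∀ c c' : Fin d → ZMod 2, L (c + c') = L c + L c' := fun c c' ↦ by
    simp only [hL, Pi.add_apply, map_add, add_mul, Finset.sum_add_distrib]
  have hL_zero : L 0 = 0 := by simp [hL]
  let J : (Fin d → geomTorsion W 2) →+ (Fin 2 → k) :=
    { toFun := fun x i ↦ L (fun j ↦ e (x j) i)
      map_zero' := by
        funext i
        change L (fun j ↦ e 0 i) = 0
        simp only [map_zero, Pi.zero_apply]
        exact hL_zero
      map_add' := fun x y ↦ by
        funext i
        change L (fun j ↦ e (x j + y j) i) = L (fun j ↦ e (x j) i) + L (fun j ↦ e (y j) i)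
        rw [← hL_add]
        congr 1
        funext j
        rw [map_add]; rfl }
  have hJ : ∀ x i, J x i = ∑ j, f (e (x j) i) * b j := fun _ _ ↦ rfl
  have hinj : Function.Injective J := by
    intro x y hxy
    funext j
    apply e.injective
    funext i
    have hi : L (fun j ↦ e (x j) i) = L (fun j ↦ e (y j) i) := congr_fun hxy i
    exact congr_fun (hb.1 hi) j
  have hsurj : Function.Surjective J := by
    intro t
    choose c hc using fun i ↦ hb.2 (t i)
    refine ⟨fun j ↦ e.symm (fun i ↦ c i j), funext fun i ↦ ?_⟩
    change L (fun j ↦ e (e.symm fun i ↦ c i j) i) = t i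
    simp only [AddEquiv.apply_symm_apply]
    exact hc i
  refine ⟨AddEquiv.ofBijective J ⟨hinj, hsurj⟩, fun σ x ↦ ?_⟩
  change J (fun j ↦ σ • x j) = (rhoMat W e σ).map f *ᵥ J x
  funext i
  have hx : ∀ j, e (σ • x j) = rhoMat W e σ *ᵥ e (x j) := fun j ↦ rhoMat_mulVec W e σ (x j)
  simp only [hJ, hx, Matrix.mulVec, dotProduct, Matrix.map_apply, Fin.sum_univ_two, map_add, map_mul, add_mul,
    Finset.sum_add_distrib, Finset.mul_sum, mul_assoc]

end TorsionCarrier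

/-! ### §4. The residue field `k = 𝒪/ϖ`: finite, of characteristic `2`, with an `𝔽₂`-basis -/

section ResidueField

variable (S : Set (PadicAlgCl 2)) [FiniteDimensional ℚ_[2] ↥(padicCoeffField S)]

/-- `k = 𝒪/(ϖ)` is finite and `2 ∈ (ϖ)`, for `𝒪 = padicCoeffIntegers S` (`ℚ₂(S)/ℚ₂` finite) and a uniformiser `ϖ` — transport of
`LambdaLowerBoundO.finite_quotient_maximalIdeal_unitBall` along `padicCoeffIntegers_eq_unitBall`. [cite: NeukirchANT1999, Ch. II (4.8)] -/
theorem finite_residueField_and_two_mem :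
    ∀ ϖ : ↥(padicCoeffIntegers S), Irreducible ϖ →
      Finite (↥(padicCoeffIntegers S) ⧸ Ideal.span {ϖ}) ∧ (2 : ↥(padicCoeffIntegers S)) ∈ Ideal.span {ϖ} := by
  rw [padicCoeffIntegers_eq_unitBall S]
  intro ϖ hϖ
  haveI := LambdaLowerBoundO.isDiscreteValuationRing_unitBall 2 (padicCoeffField S)
  rw [← (IsDiscreteValuationRing.irreducible_iff_uniformizer ϖ).mp hϖ]
  refine ⟨LambdaLowerBoundO.finite_quotient_maximalIdeal_unitBall 2 _, ?_⟩
  have h := Literature.NumberTheory.Automorphic.PadicIntermediateField.natCast_prime_mem_maximalIdeal 2 (padicCoeffField S)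
  exact_mod_cast h

/-- **`k = 𝒪/(ϖ)` is a finite field of characteristic `2` with an `𝔽₂`-basis**: there are a ring map `f : 𝔽₂ → k`, `d > 0`
with `#k = 2^d`, and `b : Fin d → k` with `c ↦ Σ_j f(c_j) b_j` a bijection `𝔽₂^d ≅ k`. [cite: NeukirchANT1999, Ch. II (4.8)] -/
theorem exists_ringHom_basis_residueField (ϖ : ↥(padicCoeffIntegers S)) (hϖ : Irreducible ϖ) :
    ∃ (f : ZMod 2 →+* ↥(padicCoeffIntegers S) ⧸ Ideal.span {ϖ}) (d : ℕ)
      (b : Fin d → ↥(padicCoeffIntegers S) ⧸ Ideal.span {ϖ}),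
      0 < d ∧ Nat.card (↥(padicCoeffIntegers S) ⧸ Ideal.span {ϖ}) = 2 ^ d ∧
        Function.Bijective fun c : Fin d → ZMod 2 ↦ ∑ j, f (c j) * b j := by
  classical
  haveI hdvr : IsDiscreteValuationRing ↥(padicCoeffIntegers S) := by
    rw [padicCoeffIntegers_eq_unitBall]
    exact LambdaLowerBoundO.isDiscreteValuationRing_unitBall 2 _
  obtain ⟨hfin, h2⟩ := finite_residueField_and_two_mem S ϖ hϖ
  haveI := hfin
  haveI hmax : (Ideal.span {ϖ} : Ideal ↥(padicCoeffIntegers S)).IsMaximal := by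
    rw [← (IsDiscreteValuationRing.irreducible_iff_uniformizer ϖ).mp hϖ]
    exact IsLocalRing.maximalIdeal.isMaximal _
  letI : Field (↥(padicCoeffIntegers S) ⧸ Ideal.span {ϖ}) := Ideal.Quotient.field _
  have h20 : (2 : ↥(padicCoeffIntegers S) ⧸ Ideal.span {ϖ}) = 0 := by
    rw [← map_ofNat (Ideal.Quotient.mk (Ideal.span {ϖ})) 2, Ideal.Quotient.eq_zero_iff_mem]
    exact h2
  haveI : CharP (↥(padicCoeffIntegers S) ⧸ Ideal.span {ϖ}) 2 :=
    (CharP.charP_iff_prime_eq_zero Nat.prime_two).mpr (by exact_mod_cast h20)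
  haveI : Fact (Nat.Prime 2) := ⟨Nat.prime_two⟩
  letI : Algebra (ZMod 2) (↥(padicCoeffIntegers S) ⧸ Ideal.span {ϖ}) := ZMod.algebra _ 2
  haveI : Module.Finite (ZMod 2) (↥(padicCoeffIntegers S) ⧸ Ideal.span {ϖ}) := Module.Finite.of_finite
  let B := Module.finBasis (ZMod 2) (↥(padicCoeffIntegers S) ⧸ Ideal.span {ϖ})
  refine ⟨algebraMap (ZMod 2) _, Module.finrank (ZMod 2) (↥(padicCoeffIntegers S) ⧸ Ideal.span {ϖ}), ⇑B,
    Module.finrank_pos, ?_, ?_⟩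
  · letI := Fintype.ofFinite (↥(padicCoeffIntegers S) ⧸ Ideal.span {ϖ})
    rw [Nat.card_eq_fintype_card, Module.card_eq_pow_finrank (K := ZMod 2), ZMod.card]
  · have hfun : (fun c : Fin _ → ZMod 2 ↦ ∑ j, algebraMap (ZMod 2) _ (c j) * B j) = B.equivFun.symm := by
      funext c
      rw [Module.Basis.equivFun_symm_apply]
      simp only [Algebra.smul_def]
    rw [hfun]
    exact B.equivFun.symm.bijective

end ResidueField

end Summit.BirchSwinnertonDyer.BirchSwinnertonDyer.Theorems.ThetaTransport

end
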